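import Literature.Probability.RandomPlanarGeometry.ObservableDriverContinuity
import HarnessLib

/-!
# The FK observable as a bounded continuous functional on the path space `C([0, T], ℝ)`

Topic `Probability/RandomPlanarGeometry`; theorems only. Glue for layer 6 of the decomposition of
crit-ising.S17 (FK) (`Literature.Probability.LatticeModels.convergesInLawToSLE_sixteen_thirds_fkInterface`):
the passage of the observable martingales to the scaling limit tests the weak convergence of the
laws of the driving processes — "the driving processes `W_t^δ` … converge in law to `W_t` with
respect to the uniform norm on finite intervals" (Chelkak–Duminil-Copin–Hongler–Kemppainen–
Smirnov, C. R. Math. 352 (2014), Thm. 3) — against bounded continuous functionals of the path on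
`C([0, T], ℝ)`. Here: for `y > 0`, `t ≤ T`, `9t ≤ y²`, the FK observable
`w ↦ O_t^{w̄}(iy) = (iy g_t'(iy)/(g_t(iy) - w̄_t))^{1/2}` of the Loewner chain driven by the path
`w ∈ C([0, T], ℝ)` extended constantly after `T` (`Set.IccExtend`) is continuous
(`Loewner.continuous_fkObservable_IccExtend`, from the `ε`–`η` driver continuity
`ShortTime.fkObservable_driver_continuous` of `ObservableDriverContinuity.lean`) and bounded by
`2`; likewise the time-limited observable at `t ∧ y²/9`.

## References

* D. Chelkak, H. Duminil-Copin, C. Hongler, A. Kemppainen, S. Smirnov, *Convergence of Ising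
  interfaces to Schramm's SLE curves*, C. R. Math. Acad. Sci. Paris 352 (2014), Thm. 3 and §3.
-/

noncomputable section

open Set Filter Topology Metric MeasureTheory Complex
open scoped NNReal

namespace Literature.Probability.RandomPlanarGeometry

namespace Loewner

/-- **The FK observable is a continuous functional of the driving path on `C([0, T], ℝ)`** (sup
norm): for `y > 0`, `t ≤ T` with `9t ≤ y²`, `w ↦ O_t^{w̄}(iy)` is continuous, where `w̄` is the
path `w` extended constantly after `T` (`Set.IccExtend`). This is the form in which the passage
to the scaling limit consumes the driver continuity (`ShortTime.fkObservable_driver_continuous`):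
weak convergence of the laws of the driving processes on `C([0, T], ℝ)` is tested against bounded
continuous functionals. [folklore] -/
theorem continuous_fkObservable_IccExtend {y : ℝ} (hy : 0 < y) {T t : ℝ≥0} (ht : t ≤ T)
    (h9 : 9 * (t : ℝ) ≤ y ^ 2) :
    Continuous fun w : C(Icc (0 : ℝ≥0) T, ℝ) ↦
      fkObservable (IccExtend (bot_le : (0 : ℝ≥0) ≤ T) w) t (I * y) := by
  rw [Metric.continuous_iff]
  intro w₀ ε hε
  have hST : ShortTime (IccExtend (bot_le : (0 : ℝ≥0) ≤ T) w₀) (I * y) t :=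
    ⟨w₀.continuous.Icc_extend', by simpa using hy, by simpa using h9⟩
  obtain ⟨η, hη, hclose⟩ := hST.fkObservable_driver_continuous (half_pos hε)
  refine ⟨η, hη, fun w hw ↦ ?_⟩
  have hWW : ∀ s : ℝ≥0, s ≤ t →
      |IccExtend (bot_le : (0 : ℝ≥0) ≤ T) w₀ s - IccExtend (bot_le : (0 : ℝ≥0) ≤ T) w s| ≤ η := by
    intro s hs
    have hsT : s ∈ Icc (0 : ℝ≥0) T := ⟨bot_le, hs.trans ht⟩
    rw [IccExtend_of_mem (bot_le : (0 : ℝ≥0) ≤ T) w₀ hsT, IccExtend_of_mem (bot_le : (0 : ℝ≥0) ≤ T) w hsT]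
    have h1 := ContinuousMap.dist_apply_le_dist (f := w) (g := w₀) ⟨s, hsT⟩
    rw [Real.dist_eq] at h1
    rw [abs_sub_comm]
    exact h1.trans hw.le
  have := hclose (IccExtend (bot_le : (0 : ℝ≥0) ≤ T) w) (w.continuous.Icc_extend') hWW
  rw [dist_eq_norm]
  exact this.trans_lt (half_lt_self hε)

/-- The time-limited observable `N^y_t(w̄) = O_{t ∧ y²/9}^{w̄}(iy)` is a continuous functional of
the driving path `w ∈ C([0, T], ℝ)` whenever `t ∧ y²/9 ≤ T` (`y > 0`). [folklore] -/
theorem continuous_fkObservable_min_IccExtend {y : ℝ} (hy : 0 < y) {T t : ℝ≥0}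
    (ht : min t (cdhksTime y) ≤ T) :
    Continuous fun w : C(Icc (0 : ℝ≥0) T, ℝ) ↦
      fkObservable (IccExtend (bot_le : (0 : ℝ≥0) ≤ T) w) (min t (cdhksTime y)) (I * y) := by
  refine continuous_fkObservable_IccExtend hy ht ?_
  have h1 : ((min t (cdhksTime y) : ℝ≥0) : ℝ) ≤ (cdhksTime y : ℝ) :=
    NNReal.coe_le_coe.2 (min_le_right _ _)
  rw [coe_cdhksTime] at h1
  linarith

/-- Boundedness of the functional: `‖O_{t ∧ y²/9}^{w̄}(iy)‖ ≤ 2`. [folklore] -/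
theorem norm_fkObservable_min_IccExtend_le {y : ℝ} (hy : 0 < y) (T t : ℝ≥0)
    (w : C(Icc (0 : ℝ≥0) T, ℝ)) :
    ‖fkObservable (IccExtend (bot_le : (0 : ℝ≥0) ≤ T) w) (min t (cdhksTime y)) (I * y)‖ ≤ 2 :=
  norm_fkObservable_min_le (w.continuous.Icc_extend') hy t

end Loewner

end Literature.Probability.RandomPlanarGeometry
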